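import Literature.MathematicalPhysics.QuantumFieldTheory.Balaban1983to89.T4PlaqDisjointFamilies
import Summits.QuantumFields.BalabanUV.T4Continuum.Spine.NE7.QLaCriticality

/-!
# Spine/NE7/QLaCensus — NODE S's (0.26)-type component census from two FORMAT facts (disjointness of the scale-`j`
# components of one history; the printed size cap), the age-dependent cap absorbed into the geometric profile, and the
# END FACE of NODE S with the W-fmt@1 data as explicit binders

Cell `pub-balaban-gaps` (YM blitz Y1, track G2, seat `ne7`, generation 10); text of record
`run/shared/lean/pub/pub-balaban-gaps/ne/NE7.md` (v10: §4undecies, census R62–R63).  36th `Spine/NE7/` file; 0 `def`, 0 sorry.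

WHY.  NODE S = (QL-a)∣_{U=1} of spine estimate NE7 is, in the kernel, `Spine.NE7.qla_of_defect` (file 5 `QLaCriticality` :370,
p342645): for `|t| ≤ l₀`, a per-component defect bound `|c_t(X) − c_0(X)| ≤ 2·|t|·Cd·wt X·(θ^{K − sc X})²` AND the component
census `T4RecentScale.Multiplicity wf sc wt Cw vol Λ K` (`Σ_{sc X = j} wt X ≤ Cw·vol·Λ^{K−j}`) give `Spine.NE7.QLa` with
`Ew = 2·l₀·Cd·Cw`, `a = θ²·Λ` (`= L⁻²` in d = 4 with `θ = L⁻³`, `Λ = L⁴`).  Generations 3–8 PROVED the averaging-side input of the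
defect bound (`LoopDefectBound` for [Balaban1985Averaging] (15), for [Balaban1987RG1] (0.4) and (0.10)–(0.12) on SU(N): files 20,
29, 33) and reduced the log-quotient step to `abs_log_integral_exp_sub_le` (file 5 :324).  The census text (NE7.md v9.3 §7nonies)
therefore lists TWO residual inputs of NODE S: «the FORMAT (W-fmt@1) + the (0.26) census».  This file reduces the SECOND to a COUNT
on the cell's tori, under either reading of the ledger that carries the `t`-dependent constants of ONE term of (2.18) [III]:
(a) COMPONENT-indexed (the quotients of [Balaban1989LargeFieldI] (0.3) p. 176, one per renormalised large-field component) — then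
two FORMAT facts printed about these objects suffice:
* (F-disj) the scale-`j` components of one history are connected components of ONE region `Λ^c_j`, hence PAIRWISE DISJOINT sets of
  `j`-lattice cells (p. 177: *"Each term in the expansion (2.18) [III] has a large field region Λ^c_k. It is a union of connected
  components."*);
* (F-cap) a renormalised component *"is contained in a cube of the size 100MR_k"* (p. 177 (i); typed as `B16StoppingRule.CondI`,
  whence `X.card ≤ Nsz^d` in the index model, `B16Ineq197ClassOne.card_le_pow_of_condI` — not imported here), so its cell count
  is capped by a number `S` depending on the scale only through `R_k`, i.e. through the AGE `K − k` of the scale (`R_k` is a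
  power of `log g_k⁻²`, [Balaban1987RG1] p. 257; `g_k⁻²` is affine-bounded in the age by (0.31)), uniformly in the cutoff `K`;
(b) DOMAIN-indexed (the localization domains `X` of the exponentiated form (0.5)–(0.6) p. 176, overlapping, each term with the
printed decay `exp(−κ d_k(X))` of [Balaban1989LargeFieldII] (1.100) p. 390) — then the census in print is PER CELL, the
(0.26)-type bound of [Balaban1987RG1] p. 257 (the decayed weights of the domains of one scale through a given cube sum to `≤ K₀`),
taken here as the HYPOTHESIS `hcell` and turned into the ledger census by double counting (`multiplicity_of_perCell_census`);
and, for both, ONE count: the number of `j`-lattice cells of the cell's tori is `|T^{(K)}|·(L^d)^{K−j}` (`card_site_eq_unit_mul`;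
[Balaban1987RG1] (0.1): `|T^{(j)}| = (2L^{m+K−j})^d`) — which is EXACTLY the normalisation `vol·Λ^{K−j}` of `Multiplicity` with
`vol = |T^{(K)}|` (unit-lattice sites) and `Λ = L^d`.  Pairwise-disjoint cells fill at most the lattice (`card_biUnion`), so a
weight `wt X ≤ C·S(K − sc X)·|cells X|` has slice sums `≤ C·S(K−j)·vol·Λ^{K−j}` (§1–§2); an age-dependent cap `S` with
`S(n)·aⁿ ≤ CS·a′ⁿ` is absorbed into the profile (`qla_of_profile`; for polynomial caps `S(n) = (n+1)^p` and any `a < a′` such a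
`CS` EXISTS, `exists_absorb_pow`, and likewise for polylog-of-affine caps, `exists_absorb_polylog` — so a polylogarithmic `R(g)`
costs nothing but the letter `a ↦ a′ < 1`).  §4 is the END FACE: ONE theorem `qla_of_logQuotient` whose binders are the W-fmt@1
data (per ledger entry two probability laws and a rider `G_X` with `|G_X| ≤ s_X` a.e. and `c_t(X) − c_0(X) = log∫e^{tG_X}dν₁ −
log∫e^{tG_X}dν₂`), the defect sizes `s_X ≤ Cd·wt X·(θ^{K−sc X})²` (for the loop rider of an averaged configuration supported on the
component this is `loopDefect_le_of_support`, restated as `abs_rider_le_of_support`) and the census — composing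
`abs_log_integral_exp_sub_le` with `qla_of_defect`.  Which reading route 1's (W-fmt) takes, and for (b) how the `t`-discrepancy of a
domain term inherits the rider's defect through the (0.5) exponentiation, is NODE O's business, not settled here.

AFTER THIS FILE the residual input of NODE S is W-fmt@1 ALONE — WHICH laws and WHICH rider, and under reading (b) the printed
per-cell census itself (NODE O ∕ route 1's format: that the `t`-dependent constants of the R-operation at exterior `1` are such
log-quotients, [Balaban1989LargeFieldI] (0.3) p. 176, (1.100) p. 201) — on the files' own domains (census R61 stands: print-kind
domains are row O3c's composed-averaging item).

HONEST FRAMING.  Finite-set counting, real arithmetic, one limit (`n^p rⁿ → 0`); all [folklore]; (F-disj), (F-cap), `hcell` are HYPOTHESES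
named after printed sentences, NOT assertions about Bałaban's objects (none of (2.18) [III] exists in the tree: NODE O).  NE7 NOT
proved; spine 0∕9; one fixed finite T⁴ — NOT ℝ⁴, NOT infinite volume, NOT a mass gap, NOT Clay.  No classification word moves (R10).
-/

noncomputable section

open MeasureTheory Finset Filter
open scoped BigOperators Topology

namespace Summit.QuantumFields.BalabanUV.T4Continuum.Spine.NE7

open Literature.MathematicalPhysics.QuantumFieldTheory.Balaban1983to89
open Literature.MathematicalPhysics.QuantumFieldTheory.Balaban1983to89.T4Continuum
open Literature.MathematicalPhysics.QuantumFieldTheory.Balaban1983to89.T4AvgSensitivity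
open Literature.MathematicalPhysics.QuantumFieldTheory.Balaban1983to89.T4AvgDerivBound
open Literature.MathematicalPhysics.QuantumFieldTheory.Balaban1983to89.T4RecentScale (Multiplicity)

/-! ## §1 Counting: pairwise-disjoint cells of one scale fill at most the lattice of that scale -/

section Counting

variable {ι : Type*}

/-- (F-disj) IN NUMBERS: pairwise-disjoint finite cells in a finite type have total size at most the size of the type
(`card_biUnion` + `card_le_univ`). [folklore] -/
theorem sum_card_le_card_of_pairwiseDisjoint {σ : Type*} [Fintype σ] [DecidableEq σ] (s : Finset ι) (cells : ι → Finset σ)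
    (h : (s : Set ι).PairwiseDisjoint cells) : ∑ i ∈ s, (cells i).card ≤ Fintype.card σ := by
  rw [← card_biUnion h]; exact card_le_univ _

/-- THE ONE COUNT: `|T^{(j)}| = |T^{(K)}|·(L^d)^{K−j}` for `j ≤ K` — the number of scale-`j` cells is the number of UNIT-lattice
cells times `Λ^{K−j}`, `Λ = L^d`: the normalisation of `T4RecentScale.Multiplicity` («number of scale-j cubes = Λ^{K−j} × number of
final cubes») read on the cell's tori ([Balaban1987RG1] (0.1): `2L^{m+K−j}` sites per direction). [folklore] -/
theorem card_site_eq_unit_mul (P : Params) {j : ℕ} (hj : j ≤ P.K) :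
    Fintype.card (Site P j) = Fintype.card (Site P P.K) * (P.L ^ P.d) ^ (P.K - j) := by
  rw [Site.card_site, Site.card_site]
  unfold Params.sitesPerDir
  have h : P.m + P.K - j = (P.m + P.K - P.K) + (P.K - j) := by omega
  rw [h, pow_add, ← mul_assoc, mul_pow, ← pow_mul, ← pow_mul, mul_comm (P.K - j) P.d]

/-- The same count in `ℝ`. [folklore] -/
theorem card_site_eq_unit_mul_real (P : Params) {j : ℕ} (hj : j ≤ P.K) :
    (Fintype.card (Site P j) : ℝ) = (Fintype.card (Site P P.K) : ℝ) * ((P.L : ℝ) ^ P.d) ^ (P.K - j) := by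
  rw [card_site_eq_unit_mul P hj]; push_cast; ring

/-- Bonds (`T4PlaqDisjointFamilies.card_pbond`: `|bonds of T^{(j)}| = |T^{(j)}|·d`): `|bonds of T^{(j)}| = |bonds of T^{(K)}|·(L^d)^{K−j}`
for `j ≤ K`. [folklore] -/
theorem card_pbond_eq_unit_mul_real (P : Params) {j : ℕ} (hj : j ≤ P.K) :
    (Fintype.card (PBond P j) : ℝ) = (Fintype.card (PBond P P.K) : ℝ) * ((P.L : ℝ) ^ P.d) ^ (P.K - j) := by
  rw [T4PlaqDisjointFamilies.card_pbond, T4PlaqDisjointFamilies.card_pbond, Nat.cast_mul, Nat.cast_mul,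
    card_site_eq_unit_mul_real P hj]
  ring

/-- **MULTIPLICITY FROM DISJOINT CELLS** (abstract scale-indexed cell types `S j`).  If the scale-`j` slice of the ledger has
pairwise-disjoint cells in `S j` (F-disj), `|S j| ≤ vol·Λ^{K−j}` for `j ≤ K`, and every weight is at most `C·|cells|`, then
`T4RecentScale.Multiplicity fac sc w C vol Λ K`. [folklore] -/
theorem multiplicity_of_disjoint_cells {S : ℕ → Type*} [∀ j, Fintype (S j)] [∀ j, DecidableEq (S j)] (fac : Finset ι)
    (sc : ι → ℕ) (cells : (j : ℕ) → ι → Finset (S j)) (w : ι → ℝ) {C vol Λ : ℝ} {K : ℕ}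
    (hdisj : ∀ j ≤ K, ((fac.filter fun i => sc i = j : Finset ι) : Set ι).PairwiseDisjoint (cells j))
    (hcard : ∀ j ≤ K, (Fintype.card (S j) : ℝ) ≤ vol * Λ ^ (K - j)) (hC : 0 ≤ C)
    (hw : ∀ i ∈ fac, w i ≤ C * ((cells (sc i) i).card : ℝ)) : Multiplicity fac sc w C vol Λ K := by
  intro j hj
  have hslice : ∑ i ∈ fac with sc i = j, w i ≤ ∑ i ∈ fac with sc i = j, C * ((cells j i).card : ℝ) :=
    sum_le_sum fun i hi => by
      obtain ⟨hif, hij⟩ := mem_filter.mp hi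
      subst hij
      exact hw i hif
  have hcount : (∑ i ∈ fac with sc i = j, ((cells j i).card : ℝ)) ≤ Fintype.card (S j) := by
    exact_mod_cast sum_card_le_card_of_pairwiseDisjoint _ (cells j) (hdisj j hj)
  calc ∑ i ∈ fac with sc i = j, w i ≤ ∑ i ∈ fac with sc i = j, C * ((cells j i).card : ℝ) := hslice
    _ = C * ∑ i ∈ fac with sc i = j, ((cells j i).card : ℝ) := (mul_sum _ _ _).symm
    _ ≤ C * (vol * Λ ^ (K - j)) := mul_le_mul_of_nonneg_left (hcount.trans (hcard j hj)) hC
    _ = C * vol * Λ ^ (K - j) := by ring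

/-- **MULTIPLICITY ON THE CELL'S TORI, SITE CELLS**: components given as pairwise-disjoint finite sets of scale-`j` SITES
(`Site P j`) with weights `≤ C·|cells|` satisfy `Multiplicity` with `vol = |T^{(K)}|` and `Λ = L^d` — no hypothesis on the
lattice, the count is `card_site_eq_unit_mul`. [folklore] -/
theorem multiplicity_of_disjoint_siteCells {P : Params} (fac : Finset ι) (sc : ι → ℕ)
    (cells : (j : ℕ) → ι → Finset (Site P j)) (w : ι → ℝ) {C : ℝ}
    (hdisj : ∀ j ≤ P.K, ((fac.filter fun i => sc i = j : Finset ι) : Set ι).PairwiseDisjoint (cells j)) (hC : 0 ≤ C)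
    (hw : ∀ i ∈ fac, w i ≤ C * ((cells (sc i) i).card : ℝ)) :
    Multiplicity fac sc w C (Fintype.card (Site P P.K)) ((P.L : ℝ) ^ P.d) P.K :=
  multiplicity_of_disjoint_cells fac sc cells w hdisj (fun _ hj => (card_site_eq_unit_mul_real P hj).le) hC hw

/-- **MULTIPLICITY ON THE CELL'S TORI, BOND CELLS** (the support sets `Λ_X` of `loopDefect_le_of_support` are sets of bonds):
`vol = |bonds of T^{(K)}| = d·|T^{(K)}|`, `Λ = L^d`. [folklore] -/
theorem multiplicity_of_disjoint_bondCells {P : Params} (fac : Finset ι) (sc : ι → ℕ)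
    (cells : (j : ℕ) → ι → Finset (PBond P j)) (w : ι → ℝ) {C : ℝ}
    (hdisj : ∀ j ≤ P.K, ((fac.filter fun i => sc i = j : Finset ι) : Set ι).PairwiseDisjoint (cells j)) (hC : 0 ≤ C)
    (hw : ∀ i ∈ fac, w i ≤ C * ((cells (sc i) i).card : ℝ)) :
    Multiplicity fac sc w C (Fintype.card (PBond P P.K)) ((P.L : ℝ) ^ P.d) P.K := by
  classical
  exact multiplicity_of_disjoint_cells fac sc cells w hdisj (fun _ hj => (card_pbond_eq_unit_mul_real P hj).le) hC hw

/-- **MULTIPLICITY FROM THE PRINTED PER-CELL CENSUS** (double counting).  Reading (b) of the ledger: the `t`-constants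
are indexed by the LOCALIZATION DOMAINS `X` of the exponentiated form [Balaban1989LargeFieldI] (0.5)–(0.6) (overlapping
connected unions of cubes, each weight carrying the printed decay `exp(−κ d_k(X))` of [Balaban1989LargeFieldII] (1.100)), and
the census in print is PER CELL — [Balaban1987RG1] (0.26) p. 257: the sum over the domains of one scale through a given cube of
the decayed weights is `≤ K₀`.  If every domain has a non-empty cell set, weights are `≥ 0`, and for every scale-`j` cell `x` the
domains of the slice through `x` weigh at most `Cw` in total (the printed shape, a HYPOTHESIS here), then
`T4RecentScale.Multiplicity fac sc w Cw vol Λ K` on cell types of size `≤ vol·Λ^{K−j}`: `Σ_{sc X = j} w X ≤ Σ_X Σ_{x ∈ cells X} w X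
= Σ_x Σ_{X ∋ x} w X ≤ |S j|·Cw`. [folklore] -/
theorem multiplicity_of_perCell_census {S : ℕ → Type*} [∀ j, Fintype (S j)] [∀ j, DecidableEq (S j)] (fac : Finset ι)
    (sc : ι → ℕ) (cells : (j : ℕ) → ι → Finset (S j)) (w : ι → ℝ) {Cw vol Λ : ℝ} {K : ℕ}
    (hne : ∀ i ∈ fac, (cells (sc i) i).Nonempty) (hw : ∀ i ∈ fac, 0 ≤ w i)
    (hcell : ∀ j ≤ K, ∀ x : S j, ∑ i ∈ (fac.filter fun i => sc i = j) with x ∈ cells j i, w i ≤ Cw)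
    (hcard : ∀ j ≤ K, (Fintype.card (S j) : ℝ) ≤ vol * Λ ^ (K - j)) (hCw : 0 ≤ Cw) : Multiplicity fac sc w Cw vol Λ K := by
  intro j hj
  set sl : Finset ι := fac.filter fun i => sc i = j with hsl
  -- each domain is counted at least once over its own cells
  have h1 : ∑ i ∈ sl, w i ≤ ∑ i ∈ sl, ∑ x ∈ cells j i, w i := sum_le_sum fun i hi => by
    obtain ⟨hif, hij⟩ := mem_filter.mp hi
    subst hij
    rw [sum_const, nsmul_eq_mul]
    have hc : (1 : ℝ) ≤ (cells (sc i) i).card := by exact_mod_cast (hne i hif).card_pos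
    nlinarith [hw i hif]
  -- exchange the two sums through indicator form
  have h2 : ∑ i ∈ sl, ∑ x ∈ cells j i, w i = ∑ x : S j, ∑ i ∈ sl with x ∈ cells j i, w i := by
    have hrow : ∀ i ∈ sl, ∑ x ∈ cells j i, w i = ∑ x : S j, if x ∈ cells j i then w i else 0 := fun i _ => by
      rw [← sum_filter]; congr 1; ext x; simp
    rw [sum_congr rfl hrow, sum_comm]
    exact sum_congr rfl fun x _ => (sum_filter _ _).symm
  calc ∑ i ∈ sl, w i ≤ ∑ i ∈ sl, ∑ x ∈ cells j i, w i := h1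
    _ = ∑ x : S j, ∑ i ∈ sl with x ∈ cells j i, w i := h2
    _ ≤ ∑ _x : S j, Cw := sum_le_sum fun x _ => hcell j hj x
    _ = (Fintype.card (S j) : ℝ) * Cw := by rw [sum_const, nsmul_eq_mul, Finset.card_univ]
    _ ≤ vol * Λ ^ (K - j) * Cw := mul_le_mul_of_nonneg_right (hcard j hj) hCw
    _ = Cw * vol * Λ ^ (K - j) := by ring

end Counting

/-! ## §2 The printed cap is AGE-dependent: slice sums with a profile `S(K − j)`, and its absorption into the geometric rate -/

section Cap

variable {ι : Type*}

/-- (F-cap) IN NUMBERS: if every weight is at most `C·S(K − sc i)·|cells i|` — `S` the cell cap of a renormalised component as a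
function of the AGE of its scale ([Balaban1989LargeFieldI] p. 177 (i): «contained in a cube of the size 100MR_k», `R_k = R(g_k)`) —
and the scale-`j` cells are pairwise disjoint in a type of size `≤ vol·Λ^{K−j}`, then the scale-`j` slice is at most
`C·S(K−j)·vol·Λ^{K−j}`. [folklore] -/
theorem slice_le_of_disjoint_cells_capped {S : ℕ → Type*} [∀ j, Fintype (S j)] [∀ j, DecidableEq (S j)] (fac : Finset ι)
    (sc : ι → ℕ) (cells : (j : ℕ) → ι → Finset (S j)) (w : ι → ℝ) (Scap : ℕ → ℝ) {C vol Λ : ℝ} {K : ℕ}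
    (hdisj : ∀ j ≤ K, ((fac.filter fun i => sc i = j : Finset ι) : Set ι).PairwiseDisjoint (cells j))
    (hcard : ∀ j ≤ K, (Fintype.card (S j) : ℝ) ≤ vol * Λ ^ (K - j)) (hC : 0 ≤ C) (hS : ∀ n, 0 ≤ Scap n)
    (hw : ∀ i ∈ fac, w i ≤ C * Scap (K - sc i) * ((cells (sc i) i).card : ℝ)) :
    ∀ j ≤ K, ∑ i ∈ fac with sc i = j, w i ≤ C * Scap (K - j) * vol * Λ ^ (K - j) := by
  intro j hj
  have hslice : ∑ i ∈ fac with sc i = j, w i ≤ ∑ i ∈ fac with sc i = j, C * Scap (K - j) * ((cells j i).card : ℝ) :=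
    sum_le_sum fun i hi => by
      obtain ⟨hif, hij⟩ := mem_filter.mp hi
      subst hij
      exact hw i hif
  have hcount : (∑ i ∈ fac with sc i = j, ((cells j i).card : ℝ)) ≤ Fintype.card (S j) := by
    exact_mod_cast sum_card_le_card_of_pairwiseDisjoint _ (cells j) (hdisj j hj)
  have hCS : 0 ≤ C * Scap (K - j) := mul_nonneg hC (hS _)
  calc ∑ i ∈ fac with sc i = j, w i ≤ ∑ i ∈ fac with sc i = j, C * Scap (K - j) * ((cells j i).card : ℝ) := hslice
    _ = C * Scap (K - j) * ∑ i ∈ fac with sc i = j, ((cells j i).card : ℝ) := (mul_sum _ _ _).symm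
    _ ≤ C * Scap (K - j) * (vol * Λ ^ (K - j)) := mul_le_mul_of_nonneg_left (hcount.trans (hcard j hj)) hCS
    _ = C * Scap (K - j) * vol * Λ ^ (K - j) := by ring

variable {D : Type*}

/-- **PER-COMPONENT BOUND × CAPPED CENSUS ⟹ (QL-a) WITH A PROFILE.**  `QLaPt wf sc wt ct c0 K E b` and slice sums
`Σ_{sc X = j} wt X ≤ Cw·S(K−j)·vol·Λ^{K−j}` give the scale-`j` slice of the `t`-discrepancy `≤ vol·(E·Cw)·(S(K−j)·(b·Λ)^{K−j})` —
`Spine.NE7.qla_of_pt_multiplicity` (p340302) with the age-dependent cap carried along. [folklore] -/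
theorem slice_le_profile_of_pt_capped {wf : Finset D} {sc : D → ℕ} {wt ct c0 : D → ℝ} {K : ℕ} {E b Cw vol Λ : ℝ}
    (Scap : ℕ → ℝ) (hpt : QLaPt wf sc wt ct c0 K E b)
    (hM : ∀ j ≤ K, ∑ X ∈ wf with sc X = j, wt X ≤ Cw * Scap (K - j) * vol * Λ ^ (K - j)) (hE : 0 ≤ E) (hb : 0 ≤ b) :
    ∀ j ≤ K, ∑ X ∈ wf with sc X = j, |ct X - c0 X| ≤ vol * (E * Cw * (Scap (K - j) * (b * Λ) ^ (K - j))) := by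
  intro j hj
  calc ∑ X ∈ wf with sc X = j, |ct X - c0 X|
      ≤ ∑ X ∈ wf with sc X = j, E * b ^ (K - j) * wt X := sum_le_sum fun X hX => by
          obtain ⟨hXw, hXj⟩ := mem_filter.mp hX
          calc |ct X - c0 X| ≤ E * wt X * b ^ (K - sc X) := hpt X hXw
            _ = E * b ^ (K - j) * wt X := by rw [hXj]; ring
    _ = E * b ^ (K - j) * ∑ X ∈ wf with sc X = j, wt X := (mul_sum _ _ _).symm
    _ ≤ E * b ^ (K - j) * (Cw * Scap (K - j) * vol * Λ ^ (K - j)) :=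
        mul_le_mul_of_nonneg_left (hM j hj) (mul_nonneg hE (pow_nonneg hb _))
    _ = vol * (E * Cw * (Scap (K - j) * (b * Λ) ^ (K - j))) := by rw [mul_pow]; ring

/-- **ABSORPTION OF AN AGE-DEPENDENT CAP INTO THE GEOMETRIC PROFILE.**  If the scale-`j` slices of the `t`-discrepancy are at most
`vol·Ew·S(K−j)·a^{K−j}` and the cap is dominated by a slower rate, `S(n)·aⁿ ≤ CS·a′ⁿ` for all `n`, then `Spine.NE7.QLa` holds with
size constant `Ew·CS` and ratio `a′`.  (The consumer displays `a′ < 1`; any `a′ ∈ (a, 1)` works for a polynomial cap, §2's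
`exists_absorb_pow`.) [folklore] -/
theorem qla_of_profile {wf : Finset D} {sc : D → ℕ} {ct c0 : D → ℝ} {K : ℕ} {vol Ew a a' CS : ℝ} (Scap : ℕ → ℝ)
    (h : ∀ j ≤ K, ∑ X ∈ wf with sc X = j, |ct X - c0 X| ≤ vol * (Ew * (Scap (K - j) * a ^ (K - j))))
    (habs : ∀ n, Scap n * a ^ n ≤ CS * a' ^ n) (hvol : 0 ≤ vol) (hEw : 0 ≤ Ew) : QLa wf sc ct c0 K vol (Ew * CS) a' := by
  intro j hj
  refine (h j hj).trans ?_
  have := habs (K - j)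
  calc vol * (Ew * (Scap (K - j) * a ^ (K - j))) ≤ vol * (Ew * (CS * a' ^ (K - j))) :=
        mul_le_mul_of_nonneg_left (mul_le_mul_of_nonneg_left this hEw) hvol
    _ = vol * (Ew * CS * a' ^ (K - j)) := by ring

/-- **A POLYNOMIAL CAP COSTS ONLY THE LETTER `a ↦ a′`**: for `0 ≤ a < a′` and any power `p` there is `CS ≥ 0` with
`(n+1)^p·aⁿ ≤ CS·a′ⁿ` for every `n` (from `n^p·rⁿ → 0` for `0 ≤ r < 1`, Mathlib `tendsto_pow_const_mul_const_pow_of_lt_one`).  So a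
cap growing polynomially in the age — in particular any power of a polylogarithmic `R(g_k)` along an asymptotically free
trajectory, where `g_k^{−2}` grows at most linearly in the age — leaves (QL-a)'s letter `a′ < 1` intact whenever `a < 1`. [folklore] -/
theorem exists_absorb_pow (p : ℕ) {a a' : ℝ} (ha : 0 ≤ a) (haa' : a < a') :
    ∃ CS : ℝ, 0 ≤ CS ∧ ∀ n : ℕ, ((n : ℝ) + 1) ^ p * a ^ n ≤ CS * a' ^ n := by
  have ha' : 0 < a' := ha.trans_lt haa'
  rcases ha.eq_or_lt with rfl | ha0
  · refine ⟨1, zero_le_one, fun n => ?_⟩  -- `a = 0`: only `n = 0` is non-trivial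
    rcases Nat.eq_zero_or_pos n with rfl | hn
    · simp
    · rw [zero_pow hn.ne', mul_zero]
      exact mul_nonneg zero_le_one (pow_nonneg ha'.le n)
  · set r : ℝ := a / a' with hr  -- `0 < a < a'`: `r = a/a' ∈ (0,1)`, `m^p r^m ≤ B`, shift `m = n + 1`
    have hr0 : 0 ≤ r := div_nonneg ha ha'.le
    have hr1 : r < 1 := (div_lt_one ha').mpr haa'
    obtain ⟨B, hB⟩ := (tendsto_pow_const_mul_const_pow_of_lt_one p hr0 hr1).bddAbove_range
    have hBm : ∀ m : ℕ, (m : ℝ) ^ p * r ^ m ≤ B := fun m => hB ⟨m, rfl⟩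
    have hB0 : 0 ≤ B := (mul_nonneg (pow_nonneg (Nat.cast_nonneg 1) p) (pow_nonneg hr0 1)).trans (hBm 1)
    refine ⟨B * a' / a, div_nonneg (mul_nonneg hB0 ha'.le) ha0.le, fun n => ?_⟩
    have key := hBm (n + 1)
    rw [Nat.cast_add, Nat.cast_one, hr, div_pow, pow_succ, pow_succ] at key
    -- key : (n+1)^p * (a^n * a / (a'^n * a')) ≤ B
    have ha'n : 0 < a' ^ n * a' := mul_pos (pow_pos ha' n) ha'
    rw [mul_div_assoc'] at key
    rw [div_le_iff₀ ha'n] at key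
    -- key : (n+1)^p * (a^n * a) ≤ B * (a'^n * a')
    rw [div_mul_eq_mul_div, le_div_iff₀ ha0]
    calc ((n : ℝ) + 1) ^ p * a ^ n * a = ((n : ℝ) + 1) ^ p * (a ^ n * a) := by ring
      _ ≤ B * (a' ^ n * a') := key
      _ = B * a' * a' ^ n := by ring

/-- **THE PRINTED CAP IS OF THIS KIND**: a polylogarithm of an affine function of the age — `(log(A + B·n))^q` with `A ≥ 1`,
`B ≥ 0`, the shape of `(100·M·R_k)^d` when `R_k` is a power of `log g_k⁻²` ([Balaban1987RG1] p. 257: `R_j ≥ (log g_j⁻²)^r`) and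
`g_k⁻²` is affine-bounded in the age `K − k` ((0.31): `1/g_k² ≤ 1/g² + β′·log(L^kε)⁻¹ = 1/g² + β′·(K − k)·log L`) — is dominated by
`(A + B)^q·(n+1)^q` (`log x ≤ x`), hence absorbed: `∃ CS ≥ 0, ∀ n, (log(A + B·n))^q·aⁿ ≤ CS·a′ⁿ` for any `0 ≤ a < a′`.  (Which
power `q` and which `A, B` is NODE O's ∕ the β-binder's business; only the KIND «polylog of affine» is used.) [folklore] -/
theorem exists_absorb_polylog (q : ℕ) {A B a a' : ℝ} (hA : 1 ≤ A) (hB : 0 ≤ B) (ha : 0 ≤ a) (haa' : a < a') :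
    ∃ CS : ℝ, 0 ≤ CS ∧ ∀ n : ℕ, Real.log (A + B * n) ^ q * a ^ n ≤ CS * a' ^ n := by
  obtain ⟨C0, hC0, hC⟩ := exists_absorb_pow q ha haa'
  have hAB : 0 ≤ A + B := by linarith
  refine ⟨(A + B) ^ q * C0, mul_nonneg (pow_nonneg hAB q) hC0, fun n => ?_⟩
  have hn : (0 : ℝ) ≤ n := Nat.cast_nonneg n
  have h1 : 1 ≤ A + B * n := le_add_of_le_of_nonneg hA (mul_nonneg hB hn)
  have hlog0 : 0 ≤ Real.log (A + B * n) := Real.log_nonneg h1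
  have hlog : Real.log (A + B * n) ≤ (A + B) * ((n : ℝ) + 1) := by
    calc Real.log (A + B * n) ≤ A + B * n := Real.log_le_self (by linarith)
      _ ≤ (A + B) * ((n : ℝ) + 1) := by nlinarith
  calc Real.log (A + B * n) ^ q * a ^ n ≤ ((A + B) * ((n : ℝ) + 1)) ^ q * a ^ n :=
        mul_le_mul_of_nonneg_right (pow_le_pow_left₀ hlog0 hlog q) (pow_nonneg ha n)
    _ = (A + B) ^ q * (((n : ℝ) + 1) ^ q * a ^ n) := by rw [mul_pow]; ring
    _ ≤ (A + B) ^ q * (C0 * a' ^ n) := mul_le_mul_of_nonneg_left (hC n) (pow_nonneg hAB q)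
    _ = (A + B) ^ q * C0 * a' ^ n := by ring

end Cap

/-! ## §3 The loop rider of an averaged configuration: its range is the defect -/

section Rider

variable {P : Params} {G : Type*} [GaugeGroup G]

/-- The rider `G = W̃ − 1` of NODE S has `|G| = 1 − W̃`: a defect bound IS a range bound. [folklore] -/
theorem abs_loopAt_sub_one_le {j : ℕ} (U : GaugeField P j G) (γ : List (LStep P j)) {s : ℝ} (h : 1 - loopAt U γ ≤ s) :
    |loopAt U γ - 1| ≤ s := by
  rwa [abs_sub_comm, abs_of_nonneg (loopDefect_nonneg U γ)]

/-- **THE RIDER'S RANGE ON A SUPPORTED COMPONENT** (`loopDefect_le_of_support`, file 5, restated for the rider): under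
`LoopDefectBound av dom Cd θ`, a level-`k` configuration `V ∈ dom k` trivial off a finite bond set `Λ` with one-bond deviations
`≤ Dm` on `Λ` has, `n` levels up and along any closed walk `(x, w)`, `|W(avgⁿ V) − 1| ≤ Cd·(|w|·|Λ|·Dm)²·(θ²)ⁿ` — the defect SIZE
`s_X` of §4 with weight `wt X = (|w|·|Λ_X|·Dm)²`, which (F-cap) bounds by `(|w|·Dm)²·S(age)·|Λ_X|`.  The support datum
`V ∈ dom k`, `dist1 (V b) ≤ Dm` is of the printed KIND of the (1.100) inserts ([Balaban1989LargeFieldI] p. 196: «|V′ − 1| <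
O(1)M²NR_k⁴ε_k on B₀», census R31 ∕ R43): `Dm` too is a polylogarithm of `g_k⁻²` times the scale factor, so every age-dependent
polylog (the cap's and the radius') is collected in ONE profile `S` of §2; the radius-vs-domain bookkeeping is census R61 ∕ NE1′'s (β),
not touched here. [folklore] -/
theorem abs_rider_le_of_support {av : ∀ j, Averaging P j G} {dom : ∀ j, Set (GaugeField P j G)} {Cd θ : ℝ}
    (h : LoopDefectBound av dom Cd θ) (hCd : 0 ≤ Cd) (hθ : 0 ≤ θ) {k n : ℕ} (hn : k + n ≤ P.m + P.K)
    (x : Site P (k + n)) (w : List (Letter P.d)) (hw : walkEnd x w = x) (V : GaugeField P k G) (hV : V ∈ dom k)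
    (h1 : (1 : GaugeField P k G) ∈ dom k) (Λ : Finset (PBond P k)) (hoff : ∀ b, b ∉ Λ → V b = 1) {Dm : ℝ}
    (hD : ∀ b ∈ Λ, dist1 (V b) ≤ Dm) :
    |loopAt (iterFrom av k n V) (walk x w) - 1| ≤ Cd * ((w.length : ℝ) * Λ.card * Dm) ^ 2 * (θ ^ 2) ^ n :=
  abs_loopAt_sub_one_le _ _ (loopDefect_le_of_support h hCd hθ hn x w hw V hV h1 Λ hoff hD)

end Rider

/-! ## §4 The END FACE of NODE S: W-fmt@1 data + defect sizes + census ⟹ (QL-a) -/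

section EndFace

variable {D : Type*} {Ω : Type*} [MeasurableSpace Ω]

/-- **NODE S, END FACE** (bookkeeping).  Binders = the W-fmt@1 data of NODE O ∕ route 1's format, per component `X` of the
ledger: two probability laws `ν₁ X`, `ν₂ X` (the normalised numerator ∕ denominator fibre laws of the large-field quotient at
exterior `1`, [Balaban1989LargeFieldI] (0.3) p. 176) and a rider `G X` (the loop variable of the averaged configuration minus
its flat value) with `|G X| ≤ s X` a.e. for both laws, such that the `t`-discrepancy of the component's constant IS the
log-quotient discrepancy `c_t(X) − c_0(X) = log∫e^{t·G X}dν₁ X − log∫e^{t·G X}dν₂ X`; plus the defect sizes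
`s X ≤ Cd·wt X·(θ^{K − sc X})²` (§3 ∕ `LoopDefectBound`, PROVED for the printed averagings on the files' domains) and the census
`Multiplicity wf sc wt Cw vol Λ K` (§1–§2 from (F-disj) + (F-cap)).  Conclusion: `Spine.NE7.QLa wf sc ct c0 K vol (2·l₀·Cd·Cw) (θ²·Λ)`
for `|t| ≤ l₀` — `abs_log_integral_exp_sub_le` composed with `qla_of_defect`.  Nothing about the laws is used beyond the rider's
range: no symmetry, no conditional mean, no covariance. [folklore] -/
theorem qla_of_logQuotient {wf : Finset D} {sc : D → ℕ} {wt ct c0 : D → ℝ} {K : ℕ} {l₀ Cd θ t Cw vol Λ : ℝ}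
    (ht : |t| ≤ l₀) (hCd : 0 ≤ Cd) (hwt : ∀ X ∈ wf, 0 ≤ wt X)
    (ν₁ ν₂ : D → Measure Ω) [∀ X, IsProbabilityMeasure (ν₁ X)] [∀ X, IsProbabilityMeasure (ν₂ X)] (G : D → Ω → ℝ)
    (hG₁ : ∀ X ∈ wf, AEStronglyMeasurable (G X) (ν₁ X)) (hG₂ : ∀ X ∈ wf, AEStronglyMeasurable (G X) (ν₂ X)) (s : D → ℝ)
    (hb₁ : ∀ X ∈ wf, ∀ᵐ ω ∂(ν₁ X), |G X ω| ≤ s X) (hb₂ : ∀ X ∈ wf, ∀ᵐ ω ∂(ν₂ X), |G X ω| ≤ s X)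
    (hfmt : ∀ X ∈ wf, ct X - c0 X =
      Real.log (∫ ω, Real.exp (t * G X ω) ∂(ν₁ X)) - Real.log (∫ ω, Real.exp (t * G X ω) ∂(ν₂ X)))
    (hs : ∀ X ∈ wf, s X ≤ Cd * wt X * (θ ^ (K - sc X)) ^ 2) (hM : Multiplicity wf sc wt Cw vol Λ K) :
    QLa wf sc ct c0 K vol (2 * l₀ * Cd * Cw) (θ ^ 2 * Λ) := by
  refine qla_of_defect ht hCd hwt (fun X hX => ?_) hM
  rw [hfmt X hX]
  refine (abs_log_integral_exp_sub_le (ν₁ X) (ν₂ X) (hG₁ X hX) (hG₂ X hX) (hb₁ X hX) (hb₂ X hX) t).trans ?_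
  exact mul_le_mul_of_nonneg_left (mul_le_mul_of_nonneg_left (hs X hX) (abs_nonneg t)) zero_le_two

/-- **NODE S, END FACE WITH THE CAPPED CENSUS** (the same with §1–§2 inlined): W-fmt@1 data, defect sizes in the SECOND-order
currency `b = θ²` with weights `wt X ≤ C·S(K − sc X)·|cells X|`, pairwise-disjoint scale-`j` cells in types of size `≤ vol·Λ^{K−j}`
(on the cell's tori: `vol = |T^{(K)}|`, `Λ = L^d`, §1), and a cap dominated by a slower rate `S(n)·(θ²Λ)ⁿ ≤ CS·a′ⁿ`:
`Spine.NE7.QLa wf sc ct c0 K vol (2·l₀·Cd·C·CS) a′`.  In d = 4 with `θ = L⁻³`, `Λ = L⁴`: `θ²Λ = L⁻²` and any `a′ ∈ (L⁻², 1)`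
serves (`exists_absorb_pow`). [folklore] -/
theorem qla_of_logQuotient_capped {ι : Type*} {S : ℕ → Type*} [∀ j, Fintype (S j)] [∀ j, DecidableEq (S j)]
    {wf : Finset ι} {sc : ι → ℕ} {wt ct c0 : ι → ℝ} {K : ℕ} {l₀ Cd θ t C vol Λ a' CS : ℝ}
    (ht : |t| ≤ l₀) (hCd : 0 ≤ Cd) (hwt : ∀ X ∈ wf, 0 ≤ wt X)
    (ν₁ ν₂ : ι → Measure Ω) [∀ X, IsProbabilityMeasure (ν₁ X)] [∀ X, IsProbabilityMeasure (ν₂ X)] (G : ι → Ω → ℝ)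
    (hG₁ : ∀ X ∈ wf, AEStronglyMeasurable (G X) (ν₁ X)) (hG₂ : ∀ X ∈ wf, AEStronglyMeasurable (G X) (ν₂ X)) (s : ι → ℝ)
    (hb₁ : ∀ X ∈ wf, ∀ᵐ ω ∂(ν₁ X), |G X ω| ≤ s X) (hb₂ : ∀ X ∈ wf, ∀ᵐ ω ∂(ν₂ X), |G X ω| ≤ s X)
    (hfmt : ∀ X ∈ wf, ct X - c0 X =
      Real.log (∫ ω, Real.exp (t * G X ω) ∂(ν₁ X)) - Real.log (∫ ω, Real.exp (t * G X ω) ∂(ν₂ X)))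
    (hs : ∀ X ∈ wf, s X ≤ Cd * wt X * (θ ^ (K - sc X)) ^ 2)
    (cells : (j : ℕ) → ι → Finset (S j)) (Scap : ℕ → ℝ)
    (hdisj : ∀ j ≤ K, ((wf.filter fun i => sc i = j : Finset ι) : Set ι).PairwiseDisjoint (cells j))
    (hcard : ∀ j ≤ K, (Fintype.card (S j) : ℝ) ≤ vol * Λ ^ (K - j)) (hC : 0 ≤ C) (hS : ∀ n, 0 ≤ Scap n)
    (hw : ∀ i ∈ wf, wt i ≤ C * Scap (K - sc i) * ((cells (sc i) i).card : ℝ))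
    (hvol : 0 ≤ vol) (habs : ∀ n, Scap n * (θ ^ 2 * Λ) ^ n ≤ CS * a' ^ n) :
    QLa wf sc ct c0 K vol (2 * l₀ * Cd * C * CS) a' := by
  -- per-component bound in the second-order currency
  have hpt : QLaPt wf sc wt ct c0 K (2 * l₀ * Cd) (θ ^ 2) := by
    refine qlaPt_of_defect ht hCd hwt fun X hX => ?_
    rw [hfmt X hX]
    refine (abs_log_integral_exp_sub_le (ν₁ X) (ν₂ X) (hG₁ X hX) (hG₂ X hX) (hb₁ X hX) (hb₂ X hX) t).trans ?_
    exact mul_le_mul_of_nonneg_left (mul_le_mul_of_nonneg_left (hs X hX) (abs_nonneg t)) zero_le_two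
  -- capped census, slice by slice
  have hM := slice_le_of_disjoint_cells_capped wf sc cells wt Scap hdisj hcard hC hS hw
  have hl₀ : 0 ≤ l₀ := (abs_nonneg t).trans ht
  have hE : 0 ≤ 2 * l₀ * Cd := mul_nonneg (mul_nonneg zero_le_two hl₀) hCd
  have hprof := slice_le_profile_of_pt_capped Scap hpt hM hE (sq_nonneg θ)
  have h := qla_of_profile Scap hprof habs hvol (mul_nonneg hE hC)
  simpa [mul_assoc] using h

end EndFace

end Summit.QuantumFields.BalabanUV.T4Continuum.Spine.NE7

end
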